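import Literature.Probability.RandomPlanarGeometry.SAWLoopErasureKestenRenewalWatson
import Literature.NumberTheory.Transcendental.CalegariDimitrovTangGAExpansion
import HarnessLib

/-!
# SRW on `ℤ³`: two-sided telescoping potentials for the weighted tails `Σ_{n>K} w(n)·p_{2n}(0)`

Topic `Literature/Probability/RandomPlanarGeometry` (the TAILS layer of the three-dimensional Green-function enclosures
`G(x) = C₀(0,x;1/6)`, `|x|₁ ≤ 3`, feeding the `(2̃,1)` loop-erasure bound of Hara–Slade–Sokal in `d = 3`).

Write `qₙ = p_{2n}(0) = C(2n,n)·uₙ/36ⁿ` (`Watson.srwLaw_three_origin`, `uₙ` = Zagier's sequence `zagierC`).  By the class laws of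
`…GreenThreeClasses` every class tail `Σ_{k ≥ K} p_{2k+s}(x)`, `|x|₁ ≤ 3`, is a fixed rational combination of the four
weighted tails `Σ_{n>K} w(n) qₙ` with `w(n) ∈ {1, 1/(2n−1), 1/n, 1/(n−1)}`.  This file bounds each of them on BOTH sides by
`θ(K)·q_K` with explicit rational potentials `θ`, by the telescoping-potential method of `…KestenRenewalWatson` run in
both directions:

* §1 the abstract lemmas: if `q_{m+1} ≤ r(m) q_m` and `(w(m+1) + θ(m+1))·r(m) ≤ θ(m)` then `Σ_{K<n≤K+M} w(n)qₙ ≤ θ(K) q_K`;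
  dually, if `r(m) q_m ≤ q_{m+1}` and `θ(m) ≤ (w(m+1) + θ(m+1))·r(m)` then
  `θ(K) q_K ≤ Σ_{K<n≤K+M} w(n) qₙ + θ(K+M) q_{K+M}`, and the boundary term is removed along a subsequence by the
  elementary fact that a summable non-negative sequence has `liminf (n+1)·aₙ = 0` (harmonic divergence);
* §2 a ratio MINORANT from Zagier's recurrence `(n+2)² uₙ₊₂ = (10n²+30n+23) uₙ₊₁ − 9(n+1)² uₙ`:
  `9·(16n⁵ − 16n⁴ + 20n³ − 25n² + 29n − 36)·uₙ ≤ 16n⁵·uₙ₊₁` (`n ≥ 3`), i.e. `q_{n+1} ≥ ρ₋(n) qₙ` with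
  `ρ₋(n) = (2n+1)(16n⁵ − … − 36)/(32(n+1)n⁵) = 1 − 3/(2n) + … ` exact to order `n⁻⁴` (the majorant
  `Watson.cubicReturnRatio`, exact to order `n⁻³`, is the tree's); the closure defect is a polynomial identity with
  non-negative coefficients in `n − 3`;
* §3 the eight potentials (upper/lower for the four weights), truncations of the exact asymptotic series of
  `Σ_{n>K} w(n)qₙ / q_K` in `1/K` with the last coefficient rounded outward, and their closures (`field_simp; ring` identities
  with manifestly non-negative numerators, for `K ≥ 1` upward and `K ≥ 40` downward);
* §4 the resulting two-sided bounds and summability of the four weighted tails, for every `K ≥ 40`.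

Widths at `K = 255`: `(θ⁺−θ⁻)(255)·q₂₅₅ ≈ 6.6·10⁻¹¹` (`w = 1`), `≤ 10⁻¹¹` (the other three).  No number is taken from
print; the HSS93 / CDT24 locators say where the objects come from (the cubic return probabilities and Zagier's sequence C)
and where the bounds are used (HSS93 Appendix B: the Green functions at the neighbours of the origin).

Provenance: lane «pcv-sawmu», a-idea-2 g47 (WATSON II-B, car «GREEN THREE TAILS»; design by exact rational arithmetic,
`g47/d3/{formal,potentials,closures}.py`), 2026-08-28.
-/

namespace Literature.Probability.RandomPlanarGeometry.SAW.Zd.LoopErasure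

open Finset
open Literature.Barriers.CriticalPhenomena.LongRangePhi4 (srwLaw srwLaw_nonneg)
open Literature.Probability.FitznerVanDerHofstad2017
open Literature.NumberTheory.Transcendental.CalegariDimitrovTang (zagierC zagierC_rec zagierC_three zagierC_four)

namespace GreenThree

/-! ### §1 Abstract two-sided telescoping with a weight -/

/-- **Weighted telescoping, upper side.** If `0 ≤ qₘ`, `0 ≤ w`, `q_{m+1} ≤ r(m) qₘ`, `(w(m+1) + θ(m+1)) r(m) ≤ θ(m)` and
`0 ≤ θ(m)` for `m ≥ K`, then `Σ_{j<M} w(K+1+j) q_{K+1+j} ≤ θ(K) q_K`.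
[cite: HaraSladeSokal1993, Appendix A.1 pp. 28–30 (tail of C₀(0,0;1/2d)); lane certificate] -/
theorem sum_range_weighted_le_of_potential {q r t w : ℕ → ℝ} (K : ℕ) (hq : ∀ m, 0 ≤ q m)
    (hw : ∀ m, K + 1 ≤ m → 0 ≤ w m)
    (ht : ∀ m, K ≤ m → 0 ≤ t m) (hr : ∀ m, K ≤ m → q (m + 1) ≤ r m * q m)
    (hc : ∀ m, K ≤ m → (w (m + 1) + t (m + 1)) * r m ≤ t m) (M : ℕ) :
    ∑ j ∈ range M, w (K + 1 + j) * q (K + 1 + j) ≤ t K * q K := by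
  have hΦ : ∀ M, ∑ j ∈ range M, w (K + 1 + j) * q (K + 1 + j) + t (K + M) * q (K + M) ≤ t K * q K := by
    intro M
    induction M with
    | zero => simp
    | succ M ih =>
        have hKM : K ≤ K + M := Nat.le_add_right K M
        have hwt : 0 ≤ w (K + M + 1) + t (K + M + 1) := add_nonneg (hw _ (by omega)) (ht _ (by omega))
        have hstep : (w (K + M + 1) + t (K + M + 1)) * q (K + M + 1) ≤ t (K + M) * q (K + M) :=
          calc (w (K + M + 1) + t (K + M + 1)) * q (K + M + 1)
              ≤ (w (K + M + 1) + t (K + M + 1)) * (r (K + M) * q (K + M)) :=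
                mul_le_mul_of_nonneg_left (hr _ hKM) hwt
            _ = (w (K + M + 1) + t (K + M + 1)) * r (K + M) * q (K + M) := by ring
            _ ≤ t (K + M) * q (K + M) := mul_le_mul_of_nonneg_right (hc _ hKM) (hq _)
        rw [sum_range_succ, show K + 1 + M = K + M + 1 by ring, show K + (M + 1) = K + M + 1 by ring]
        nlinarith [ih, hstep]
  have h := hΦ M
  have h0 : 0 ≤ t (K + M) * q (K + M) := mul_nonneg (ht _ (Nat.le_add_right K M)) (hq _)
  linarith

/-- **Weighted telescoping, lower side (finite form).** If `0 ≤ qₘ`, `0 ≤ w(m+1) + θ(m+1)`, `r(m) qₘ ≤ q_{m+1}` and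
`θ(m) ≤ (w(m+1) + θ(m+1)) r(m)` for `m ≥ K`, then `θ(K) q_K ≤ Σ_{j<M} w(K+1+j) q_{K+1+j} + θ(K+M) q_{K+M}`.
[cite: HaraSladeSokal1993, Appendix A.1 pp. 28–30 (tail of C₀(0,0;1/2d)); lane certificate] -/
theorem potential_le_sum_range_weighted_add {q r t w : ℕ → ℝ} (K : ℕ) (hq : ∀ m, 0 ≤ q m)
    (hwt : ∀ m, K ≤ m → 0 ≤ w (m + 1) + t (m + 1)) (hr : ∀ m, K ≤ m → r m * q m ≤ q (m + 1))
    (hc : ∀ m, K ≤ m → t m ≤ (w (m + 1) + t (m + 1)) * r m) (M : ℕ) :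
    t K * q K ≤ ∑ j ∈ range M, w (K + 1 + j) * q (K + 1 + j) + t (K + M) * q (K + M) := by
  induction M with
  | zero => simp
  | succ M ih =>
      have hKM : K ≤ K + M := Nat.le_add_right K M
      have hstep : t (K + M) * q (K + M) ≤ (w (K + M + 1) + t (K + M + 1)) * q (K + M + 1) :=
        calc t (K + M) * q (K + M) ≤ (w (K + M + 1) + t (K + M + 1)) * r (K + M) * q (K + M) :=
              mul_le_mul_of_nonneg_right (hc _ hKM) (hq _)
          _ = (w (K + M + 1) + t (K + M + 1)) * (r (K + M) * q (K + M)) := by ring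
          _ ≤ (w (K + M + 1) + t (K + M + 1)) * q (K + M + 1) :=
              mul_le_mul_of_nonneg_left (hr _ hKM) (hwt _ hKM)
      rw [sum_range_succ, show K + 1 + M = K + M + 1 by ring, show K + (M + 1) = K + M + 1 by ring]
      nlinarith [ih, hstep]

/-- **A summable non-negative sequence has `(n+1)·aₙ < ε` infinitely often** (else `aₙ ≥ ε/(n+1)` eventually and the
harmonic series would converge). [folklore] -/
private theorem exists_le_and_succ_mul_lt {a : ℕ → ℝ} (hs : Summable a) {ε : ℝ} (hε : 0 < ε) (N : ℕ) :
    ∃ n, N ≤ n ∧ ((n : ℝ) + 1) * a n < ε := by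
  by_contra h
  have h' : ∀ n, N ≤ n → ε ≤ ((n : ℝ) + 1) * a n := fun n hn => not_lt.1 fun hlt => h ⟨n, hn, hlt⟩
  have h1 : Summable fun n : ℕ => a (n + N) := (summable_nat_add_iff N).2 hs
  have h2 : Summable fun n : ℕ => ε * (1 / (((n + (N + 1) : ℕ) : ℝ))) := by
    refine Summable.of_nonneg_of_le (fun n => by positivity) (fun n => ?_) h1
    have hn := h' (n + N) (Nat.le_add_left N n)
    have hpos : (0 : ℝ) < ((n + (N + 1) : ℕ) : ℝ) := by positivity
    rw [mul_one_div, div_le_iff₀ hpos]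
    push_cast at hn ⊢
    nlinarith [hn]
  have h3 : Summable fun n : ℕ => 1 / (((n + (N + 1) : ℕ) : ℝ)) := (summable_mul_left_iff hε.ne').1 h2
  have h4 : Summable (fun n => 1 / n : ℕ → ℝ) := (summable_nat_add_iff (f := fun n : ℕ => 1 / (n : ℝ)) (N + 1)).1 h3
  exact Real.not_summable_one_div_natCast h4

/-- **Weighted telescoping, lower side (series form).** Under the hypotheses of the finite form, if moreover the weighted
tail is summable, `0 ≤ w`, `0 ≤ θ(m) ≤ c·(m+1)` beyond `K`, and `q` is summable, then `θ(K) q_K ≤ Σ_{j} w(K+1+j) q_{K+1+j}`.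
[cite: HaraSladeSokal1993, Appendix A.1 pp. 28–30 (tail of C₀(0,0;1/2d)); lane certificate] -/
theorem potential_le_tsum_weighted {q r t w : ℕ → ℝ} (K : ℕ) (hq : ∀ m, 0 ≤ q m) (hw : ∀ m, K + 1 ≤ m → 0 ≤ w m)
    (ht : ∀ m, K ≤ m → 0 ≤ t m) {c : ℝ} (hc0 : 0 ≤ c) (htc : ∀ m, K ≤ m → t m ≤ c * ((m : ℝ) + 1))
    (hr : ∀ m, K ≤ m → r m * q m ≤ q (m + 1)) (hc : ∀ m, K ≤ m → t m ≤ (w (m + 1) + t (m + 1)) * r m)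
    (hqs : Summable q) (hsum : Summable fun j => w (K + 1 + j) * q (K + 1 + j)) :
    t K * q K ≤ ∑' j, w (K + 1 + j) * q (K + 1 + j) := by
  refine le_of_forall_pos_lt_add fun ε hε => ?_
  obtain ⟨n, hKn, hn⟩ := exists_le_and_succ_mul_lt hqs (ε := ε / (c + 1)) (by positivity) K
  obtain ⟨M, rfl⟩ : ∃ M, n = K + M := ⟨n - K, by omega⟩
  have hfin := potential_le_sum_range_weighted_add (q := q) (r := r) (t := t) (w := w) K hq
    (fun m hm => add_nonneg (hw _ (by omega)) (ht _ (by omega))) hr hc M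
  have hpart : ∑ j ∈ range M, w (K + 1 + j) * q (K + 1 + j) ≤ ∑' j, w (K + 1 + j) * q (K + 1 + j) :=
    hsum.sum_le_tsum (range M) fun j _ => mul_nonneg (hw _ (by omega)) (hq _)
  have hbd : t (K + M) * q (K + M) ≤ c * ((((K + M : ℕ) : ℝ) + 1) * q (K + M)) := by
    rw [← mul_assoc]
    exact mul_le_mul_of_nonneg_right (htc _ (Nat.le_add_right K M)) (hq _)
  have hε' : c * ((((K + M : ℕ) : ℝ) + 1) * q (K + M)) ≤ c * (ε / (c + 1)) :=
    mul_le_mul_of_nonneg_left hn.le hc0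
  have hlt : c * (ε / (c + 1)) < ε := by
    rw [mul_div_assoc', div_lt_iff₀ (by positivity)]
    nlinarith
  linarith

/-! ### §2 The ratio minorant from Zagier's recurrence -/

/-- **One-sided ratio MINORANT for Zagier's sequence C:** `9·(16n⁵ − 16n⁴ + 20n³ − 25n² + 29n − 36)·uₙ ≤ 16n⁵·uₙ₊₁` for `n ≥ 3`
(i.e. `uₙ₊₁/(9uₙ) ≥ 1 − 1/n + 5/(4n²) − 25/(16n³) + 29/(16n⁴) − 9/(4n⁵)`, the true expansion continuing `−553/(256n⁵) + …`);
propagated upward by the recurrence, the closure defect being a polynomial with non-negative coefficients in `n − 3`.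
[cite: CalegariDimitrovTang2024, §11.1, eq. (zagr) with (A,B,λ) = (10,9,3) (p. 101); lane certificate] -/
theorem zagierC_succ_ge (n : ℕ) (hn : 3 ≤ n) :
    9 * (16 * (n : ℝ) ^ 5 - 16 * (n : ℝ) ^ 4 + 20 * (n : ℝ) ^ 3 - 25 * (n : ℝ) ^ 2 + 29 * n - 36) * (zagierC n : ℝ) ≤
      16 * (n : ℝ) ^ 5 * (zagierC (n + 1) : ℝ) := by
  induction n, hn using Nat.le_induction with
  | base =>
      rw [show (3 : ℕ) + 1 = 4 from rfl, zagierC_three, zagierC_four]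
      norm_num
  | succ n hn ih =>
      obtain ⟨j, rfl⟩ : ∃ j, n = j + 3 := ⟨n - 3, by omega⟩
      have hrecR : (((j + 3 : ℕ) : ℝ) + 2) ^ 2 * (zagierC (j + 3 + 2) : ℝ) -
          (10 * (((j + 3 : ℕ) : ℝ) + 1) ^ 2 + 10 * (((j + 3 : ℕ) : ℝ) + 1) + 3) * (zagierC (j + 3 + 1) : ℝ) +
            9 * (((j + 3 : ℕ) : ℝ) + 1) ^ 2 * (zagierC (j + 3) : ℝ) = 0 := by
        exact_mod_cast zagierC_rec (j + 3)
      -- slack(n) := 16 n⁵ u_{n+1} − 9 P̃(n) u_n ≥ 0 (IH); the certificate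
      --   P̃(n)(n+2)²·slack(n+1) = 256·N(n)·u_{n+1} + 16(n+1)⁷·slack(n),  256·N(j+3) ∈ ℕ[j].
      set u0 : ℝ := (zagierC (j + 3) : ℝ) with hu0
      set u1 : ℝ := (zagierC (j + 3 + 1) : ℝ) with hu1
      set u2 : ℝ := (zagierC (j + 3 + 2) : ℝ) with hu2
      have hj : (0 : ℝ) ≤ j := Nat.cast_nonneg j
      have hu1nn : (0 : ℝ) ≤ u1 := Nat.cast_nonneg _
      push_cast at ih hrecR ⊢
      have hslack0 : 0 ≤ 16 * ((j : ℝ) + 3) ^ 5 * u1 -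
          9 * (16 * ((j : ℝ) + 3) ^ 5 - 16 * ((j : ℝ) + 3) ^ 4 + 20 * ((j : ℝ) + 3) ^ 3 - 25 * ((j : ℝ) + 3) ^ 2 +
            29 * ((j : ℝ) + 3) - 36) * u0 := by linarith
      have hP : (0 : ℝ) < 16 * ((j : ℝ) + 3) ^ 5 - 16 * ((j : ℝ) + 3) ^ 4 + 20 * ((j : ℝ) + 3) ^ 3 -
          25 * ((j : ℝ) + 3) ^ 2 + 29 * ((j : ℝ) + 3) - 36 := by nlinarith [pow_nonneg hj 2, pow_nonneg hj 3, pow_nonneg hj 4, pow_nonneg hj 5]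
      have hpos : (0 : ℝ) ≤ (1743744 + 5543386 * (j : ℝ) + 5830419 * (j : ℝ) ^ 2 + 3000588 * (j : ℝ) ^ 3 +
            839666 * (j : ℝ) ^ 4 + 126642 * (j : ℝ) ^ 5 + 9003 * (j : ℝ) ^ 6 + 184 * (j : ℝ) ^ 7) * u1 +
          16 * ((j : ℝ) + 4) ^ 7 * (16 * ((j : ℝ) + 3) ^ 5 * u1 -
            9 * (16 * ((j : ℝ) + 3) ^ 5 - 16 * ((j : ℝ) + 3) ^ 4 + 20 * ((j : ℝ) + 3) ^ 3 - 25 * ((j : ℝ) + 3) ^ 2 +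
              29 * ((j : ℝ) + 3) - 36) * u0) :=
        add_nonneg (mul_nonneg (by positivity) hu1nn) (mul_nonneg (by positivity) hslack0)
      have idt : (16 * ((j : ℝ) + 3) ^ 5 - 16 * ((j : ℝ) + 3) ^ 4 + 20 * ((j : ℝ) + 3) ^ 3 - 25 * ((j : ℝ) + 3) ^ 2 +
            29 * ((j : ℝ) + 3) - 36) * ((j : ℝ) + 5) ^ 2 *
          (16 * ((j : ℝ) + 4) ^ 5 * u2 -
            9 * (16 * ((j : ℝ) + 4) ^ 5 - 16 * ((j : ℝ) + 4) ^ 4 + 20 * ((j : ℝ) + 4) ^ 3 - 25 * ((j : ℝ) + 4) ^ 2 +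
              29 * ((j : ℝ) + 4) - 36) * u1) =
          (1743744 + 5543386 * (j : ℝ) + 5830419 * (j : ℝ) ^ 2 + 3000588 * (j : ℝ) ^ 3 +
            839666 * (j : ℝ) ^ 4 + 126642 * (j : ℝ) ^ 5 + 9003 * (j : ℝ) ^ 6 + 184 * (j : ℝ) ^ 7) * u1 +
          16 * ((j : ℝ) + 4) ^ 7 * (16 * ((j : ℝ) + 3) ^ 5 * u1 -
            9 * (16 * ((j : ℝ) + 3) ^ 5 - 16 * ((j : ℝ) + 3) ^ 4 + 20 * ((j : ℝ) + 3) ^ 3 - 25 * ((j : ℝ) + 3) ^ 2 +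
              29 * ((j : ℝ) + 3) - 36) * u0) := by
        linear_combination (16 * ((j : ℝ) + 4) ^ 5 * (16 * ((j : ℝ) + 3) ^ 5 - 16 * ((j : ℝ) + 3) ^ 4 +
          20 * ((j : ℝ) + 3) ^ 3 - 25 * ((j : ℝ) + 3) ^ 2 + 29 * ((j : ℝ) + 3) - 36)) * hrecR
      rw [← idt] at hpos
      have h1 := (mul_nonneg_iff_of_pos_left (by positivity : (0 : ℝ) <
        (16 * ((j : ℝ) + 3) ^ 5 - 16 * ((j : ℝ) + 3) ^ 4 + 20 * ((j : ℝ) + 3) ^ 3 - 25 * ((j : ℝ) + 3) ^ 2 +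
            29 * ((j : ℝ) + 3) - 36) * ((j : ℝ) + 5) ^ 2)).1 hpos
      nlinarith [h1]

/-- The ratio minorant `ρ₋(x) = (2x+1)(16x⁵ − 16x⁴ + 20x³ − 25x² + 29x − 36)/(32(x+1)x⁵)` for `q_{x+1}/q_x`
(`= 1 − 3/(2(x+1)) + …`, exact to fourth order). [cite: HaraSladeSokal1993, Appendix A.1 pp. 28–30 (tail of C₀(0,0;1/2d)); lane certificate] -/
noncomputable def cubicLowerRatio (x : ℝ) : ℝ :=
  (2 * x + 1) * (16 * x ^ 5 - 16 * x ^ 4 + 20 * x ^ 3 - 25 * x ^ 2 + 29 * x - 36) / (32 * (x + 1) * x ^ 5)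

/-- **Ratio minorant for the cubic return probabilities:** `ρ₋(n) · p_{2n}(0) ≤ p_{2n+2}(0)` for `n ≥ 3`.
[cite: CalegariDimitrovTang2024, §11.1, eq. (zagr) with (A,B,λ) = (10,9,3) (p. 101); lane certificate] -/
theorem srwLaw_three_succ_ge (n : ℕ) (hn : 3 ≤ n) :
    cubicLowerRatio n * srwLaw 3 (2 * n) 0 ≤ srwLaw 3 (2 * (n + 1)) 0 := by
  have hu := zagierC_succ_ge n hn
  have hnat : (n + 1) * (2 * (n + 1)).choose (n + 1) = 2 * (2 * n + 1) * (2 * n).choose n := by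
    have h := Nat.succ_mul_centralBinom_succ n
    simpa [Nat.centralBinom_eq_two_mul_choose] using h
  have hn0 : (0 : ℝ) < n := by exact_mod_cast (show 0 < n by omega)
  have hC : ((2 * (n + 1)).choose (n + 1) : ℝ) = 2 * (2 * n + 1) / ((n : ℝ) + 1) * ((2 * n).choose n : ℝ) := by
    have h := congrArg (fun k : ℕ => (k : ℝ)) hnat
    push_cast at h
    rw [div_mul_eq_mul_div, eq_div_iff (by positivity)]
    linarith
  rw [Watson.srwLaw_three_origin, Watson.srwLaw_three_origin, hC, cubicLowerRatio, ← sub_nonneg]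
  have key : 2 * (2 * n + 1) / ((n : ℝ) + 1) * ((2 * n).choose n : ℝ) * (zagierC (n + 1) : ℝ) / 36 ^ (n + 1) -
      (2 * (n : ℝ) + 1) * (16 * (n : ℝ) ^ 5 - 16 * (n : ℝ) ^ 4 + 20 * (n : ℝ) ^ 3 - 25 * (n : ℝ) ^ 2 + 29 * n - 36) /
          (32 * ((n : ℝ) + 1) * (n : ℝ) ^ 5) * (((2 * n).choose n : ℝ) * (zagierC n : ℝ) / 36 ^ n) =
      (2 * (n : ℝ) + 1) * ((2 * n).choose n : ℝ) / (8 * (n : ℝ) ^ 5 * ((n : ℝ) + 1) * 36 ^ (n + 1)) *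
        (16 * (n : ℝ) ^ 5 * (zagierC (n + 1) : ℝ) -
          9 * (16 * (n : ℝ) ^ 5 - 16 * (n : ℝ) ^ 4 + 20 * (n : ℝ) ^ 3 - 25 * (n : ℝ) ^ 2 + 29 * n - 36) * (zagierC n : ℝ)) := by
    field_simp
    ring
  rw [key]
  exact mul_nonneg (by positivity) (sub_nonneg.2 hu)

/-! ### §3 The eight potentials and their closures

Weights `w(n) = 1, 1/(2n−1), 1/n, 1/(n−1)` ("one", "odd", "inv", "invPred"); `θ⁺` closes against the tree's majorant
`Watson.cubicReturnRatio (k+1)` for `k ≥ 1`, `θ⁻` against `cubicLowerRatio k` for `k ≥ 40`. -/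

/-- `θ⁺_one(x) = 2x + 3/(20x) − 1/(20x²)`. [cite: HaraSladeSokal1993, Appendix A.1 pp. 28–30 (tail of C₀(0,0;1/2d)); lane certificate] -/
noncomputable def thetaOneUp (x : ℝ) : ℝ := 2 * x + 3 / (20 * x) - 1 / (20 * x ^ 2)

/-- `θ⁻_one(x) = 2x + 3/(20x) − 1/(8x²)`. [cite: HaraSladeSokal1993, Appendix A.1 pp. 28–30 (tail of C₀(0,0;1/2d)); lane certificate] -/
noncomputable def thetaOneLo (x : ℝ) : ℝ := 2 * x + 3 / (20 * x) - 1 / (8 * x ^ 2)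

/-- `θ⁺_odd(x) = 1/3 − 1/(10x) + 1/(36x²)` (weight `1/(2n−1)`). [cite: HaraSladeSokal1993, Appendix B p. 32 (Green functions at the neighbours of the origin); lane certificate] -/
noncomputable def thetaOddUp (x : ℝ) : ℝ := 1 / 3 - 1 / (10 * x) + 1 / (36 * x ^ 2)

/-- `θ⁻_odd(x) = 1/3 − 1/(10x) + 1/(45x²)` (weight `1/(2n−1)`). [cite: HaraSladeSokal1993, Appendix B p. 32 (Green functions at the neighbours of the origin); lane certificate] -/
noncomputable def thetaOddLo (x : ℝ) : ℝ := 1 / 3 - 1 / (10 * x) + 1 / (45 * x ^ 2)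

/-- `θ⁺_inv(x) = 2/3 − 2/(5x) + 5/(24x²)` (weight `1/n`). [cite: HaraSladeSokal1993, Appendix B p. 32 (Green functions at the neighbours of the origin); lane certificate] -/
noncomputable def thetaInvUp (x : ℝ) : ℝ := 2 / 3 - 2 / (5 * x) + 5 / (24 * x ^ 2)

/-- `θ⁻_inv(x) = 2/3 − 2/(5x) + 1/(5x²)` (weight `1/n`). [cite: HaraSladeSokal1993, Appendix B p. 32 (Green functions at the neighbours of the origin); lane certificate] -/
noncomputable def thetaInvLo (x : ℝ) : ℝ := 2 / 3 - 2 / (5 * x) + 1 / (5 * x ^ 2)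

/-- `θ⁺_invPred(x) = 2/3 + 1/(27x²)` (weight `1/(n−1)`). [cite: HaraSladeSokal1993, Appendix B p. 32 (Green functions at the neighbours of the origin); lane certificate] -/
noncomputable def thetaInvPredUp (x : ℝ) : ℝ := 2 / 3 + 1 / (27 * x ^ 2)

/-- `θ⁻_invPred(x) = 2/3 + 1/(30x²)` (weight `1/(n−1)`). [cite: HaraSladeSokal1993, Appendix B p. 32 (Green functions at the neighbours of the origin); lane certificate] -/
noncomputable def thetaInvPredLo (x : ℝ) : ℝ := 2 / 3 + 1 / (30 * x ^ 2)

/-- Upward closure, weight `1`: `(1 + θ⁺(k+1))·ρ(k+1) ≤ θ⁺(k)`, `k ≥ 1`.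
[cite: HaraSladeSokal1993, Appendix A.1 pp. 28–30 (tail of C₀(0,0;1/2d)); lane certificate] -/
theorem thetaOneUp_closure (k : ℕ) (hk : 1 ≤ k) :
    (1 + thetaOneUp ((k : ℝ) + 1)) * Watson.cubicReturnRatio ((k : ℝ) + 1) ≤ thetaOneUp k := by
  obtain ⟨j, rfl⟩ : ∃ j, k = j + 1 := ⟨k - 1, by omega⟩
  push_cast
  rw [thetaOneUp, thetaOneUp, Watson.cubicReturnRatio, ← sub_nonneg]
  have key : 2 * ((j : ℝ) + 1) + 3 / (20 * ((j : ℝ) + 1)) - 1 / (20 * ((j : ℝ) + 1) ^ 2) -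
      (1 + (2 * ((j : ℝ) + 1 + 1) + 3 / (20 * ((j : ℝ) + 1 + 1)) - 1 / (20 * ((j : ℝ) + 1 + 1) ^ 2))) *
        ((2 * (2 * ((j : ℝ) + 1 + 1) - 1) ^ 3 - 1) / (16 * ((j : ℝ) + 1 + 1) ^ 3)) =
      (39 + 227 * (j : ℝ) + 273 * (j : ℝ) ^ 2 + 117 * (j : ℝ) ^ 3 + 16 * (j : ℝ) ^ 4) /
        (320 * ((j : ℝ) + 1) ^ 2 * ((j : ℝ) + 2) ^ 5) := by
    field_simp
    ring
  rw [key]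
  positivity

/-- Upward closure, weight `1/(2n−1)`: `(1/(2k+1) + θ⁺(k+1))·ρ(k+1) ≤ θ⁺(k)`, `k ≥ 1`.
[cite: HaraSladeSokal1993, Appendix B p. 32 (Green functions at the neighbours of the origin); lane certificate] -/
theorem thetaOddUp_closure (k : ℕ) (hk : 1 ≤ k) :
    (1 / (2 * ((k : ℝ) + 1) - 1) + thetaOddUp ((k : ℝ) + 1)) * Watson.cubicReturnRatio ((k : ℝ) + 1) ≤ thetaOddUp k := by
  obtain ⟨j, rfl⟩ : ∃ j, k = j + 1 := ⟨k - 1, by omega⟩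
  push_cast
  have h1 : ((j : ℝ) + 1) ≠ 0 := by positivity
  have h2 : ((j : ℝ) + 1 + 1) ≠ 0 := by positivity
  have h3 : (2 * ((j : ℝ) + 1 + 1) - 1) ≠ 0 := ne_of_gt (by linarith [(Nat.cast_nonneg j : (0 : ℝ) ≤ j)])
  rw [thetaOddUp, thetaOddUp, Watson.cubicReturnRatio, ← sub_nonneg]
  have key : 1 / 3 - 1 / (10 * ((j : ℝ) + 1)) + 1 / (36 * ((j : ℝ) + 1) ^ 2) -
      (1 / (2 * ((j : ℝ) + 1 + 1) - 1) + (1 / 3 - 1 / (10 * ((j : ℝ) + 1 + 1)) + 1 / (36 * ((j : ℝ) + 1 + 1) ^ 2))) *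
        ((2 * (2 * ((j : ℝ) + 1 + 1) - 1) ^ 3 - 1) / (16 * ((j : ℝ) + 1 + 1) ^ 3)) =
      (801 + 1410 * (j : ℝ) + 1093 * (j : ℝ) ^ 2 + 624 * (j : ℝ) ^ 3 + 276 * (j : ℝ) ^ 4 + 56 * (j : ℝ) ^ 5) /
        (2880 * ((j : ℝ) + 1) ^ 2 * ((j : ℝ) + 2) ^ 5 * (2 * (j : ℝ) + 3)) := by
    field_simp
    ring
  rw [key]
  positivity

/-- Upward closure, weight `1/n`: `(1/(k+1) + θ⁺(k+1))·ρ(k+1) ≤ θ⁺(k)`, `k ≥ 1`.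
[cite: HaraSladeSokal1993, Appendix B p. 32 (Green functions at the neighbours of the origin); lane certificate] -/
theorem thetaInvUp_closure (k : ℕ) (hk : 1 ≤ k) :
    (1 / ((k : ℝ) + 1) + thetaInvUp ((k : ℝ) + 1)) * Watson.cubicReturnRatio ((k : ℝ) + 1) ≤ thetaInvUp k := by
  have hk' : (0 : ℝ) < k := by exact_mod_cast hk
  rw [thetaInvUp, thetaInvUp, Watson.cubicReturnRatio, ← sub_nonneg]
  have key : 2 / 3 - 2 / (5 * (k : ℝ)) + 5 / (24 * (k : ℝ) ^ 2) -
      (1 / ((k : ℝ) + 1) + (2 / 3 - 2 / (5 * ((k : ℝ) + 1)) + 5 / (24 * ((k : ℝ) + 1) ^ 2))) *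
        ((2 * (2 * ((k : ℝ) + 1) - 1) ^ 3 - 1) / (16 * ((k : ℝ) + 1) ^ 3)) =
      (400 + 1632 * (k : ℝ) + 2495 * (k : ℝ) ^ 2 + 1627 * (k : ℝ) ^ 3 + 372 * (k : ℝ) ^ 4 + 8 * (k : ℝ) ^ 5) /
        (1920 * (k : ℝ) ^ 2 * ((k : ℝ) + 1) ^ 6) := by
    field_simp
    ring
  rw [key]
  positivity

/-- Upward closure, weight `1/(n−1)`: `(1/k + θ⁺(k+1))·ρ(k+1) ≤ θ⁺(k)`, `k ≥ 1`.
[cite: HaraSladeSokal1993, Appendix B p. 32 (Green functions at the neighbours of the origin); lane certificate] -/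
theorem thetaInvPredUp_closure (k : ℕ) (hk : 1 ≤ k) :
    (1 / (k : ℝ) + thetaInvPredUp ((k : ℝ) + 1)) * Watson.cubicReturnRatio ((k : ℝ) + 1) ≤ thetaInvPredUp k := by
  have hk' : (0 : ℝ) < k := by exact_mod_cast hk
  rw [thetaInvPredUp, thetaInvPredUp, Watson.cubicReturnRatio, ← sub_nonneg]
  have key : 2 / 3 + 1 / (27 * (k : ℝ) ^ 2) -
      (1 / (k : ℝ) + (2 / 3 + 1 / (27 * ((k : ℝ) + 1) ^ 2))) * ((2 * (2 * ((k : ℝ) + 1) - 1) ^ 3 - 1) / (16 * ((k : ℝ) + 1) ^ 3)) =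
      (16 * (k : ℝ) + 53 * (k : ℝ) ^ 2 + 51 * (k : ℝ) ^ 3 + 13 * (k : ℝ) ^ 4 + 2 * (k : ℝ) ^ 5) /
        (432 * (k : ℝ) ^ 3 * ((k : ℝ) + 1) ^ 5) := by
    field_simp
    ring
  rw [key]
  positivity

/-- Downward closure, weight `1`: `θ⁻(k) ≤ (1 + θ⁻(k+1))·ρ₋(k)`, `k ≥ 40` (the defect is a polynomial identity with
non-negative coefficients in `k − 40`). [cite: HaraSladeSokal1993, Appendix A.1 pp. 28–30 (tail of C₀(0,0;1/2d)); lane certificate] -/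
theorem thetaOneLo_closure (k : ℕ) (hk : 40 ≤ k) :
    thetaOneLo k ≤ (1 + thetaOneLo ((k : ℝ) + 1)) * cubicLowerRatio k := by
  obtain ⟨j, rfl⟩ : ∃ j, k = j + 40 := ⟨k - 40, by omega⟩
  push_cast
  have h0 : ((j : ℝ) + 40) ≠ 0 := by positivity
  have h1 : ((j : ℝ) + 40 + 1) ≠ 0 := by positivity
  have h2 : (2 * ((j : ℝ) + 40 + 1) - 1) ≠ 0 := ne_of_gt (by linarith [(Nat.cast_nonneg j : (0 : ℝ) ≤ j)])
  have h3 : (2 * ((j : ℝ) + 40) + 1) ≠ 0 := by positivity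
  rw [thetaOneLo, thetaOneLo, cubicLowerRatio, ← sub_nonneg]
  have key : (1 + (2 * ((j : ℝ) + 40 + 1) + 3 / (20 * ((j : ℝ) + 40 + 1)) - 1 / (8 * ((j : ℝ) + 40 + 1) ^ 2))) * ((2 * ((j : ℝ) + 40) + 1) * (16 * ((j : ℝ) + 40) ^ 5 - 16 * ((j : ℝ) + 40) ^ 4 + 20 * ((j : ℝ) + 40) ^ 3 - 25 * ((j : ℝ) + 40) ^ 2 + 29 * ((j : ℝ) + 40) - 36) / (32 * (((j : ℝ) + 40) + 1) * ((j : ℝ) + 40) ^ 5)) - (2 * ((j : ℝ) + 40) + 3 / (20 * ((j : ℝ) + 40)) - 1 / (8 * ((j : ℝ) + 40) ^ 2)) =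
      (738222084 + 169613061 * (j : ℝ) + 11979255 * (j : ℝ) ^ 2 + 378288 * (j : ℝ) ^ 3 + 5612 * (j : ℝ) ^ 4 + 32 * (j : ℝ) ^ 5) /
        (1280 * ((j : ℝ) + 40) ^ 5 * (((j : ℝ) + 40) + 1) ^ 3) := by
    field_simp
    ring
  rw [key]
  positivity

/-- Downward closure, weight `1/(2n−1)`: `θ⁻(k) ≤ (1/(2k+1) + θ⁻(k+1))·ρ₋(k)`, `k ≥ 40` (the defect is a polynomial identity with
non-negative coefficients in `k − 40`). [cite: HaraSladeSokal1993, Appendix B p. 32 (Green functions at the neighbours of the origin); lane certificate] -/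
theorem thetaOddLo_closure (k : ℕ) (hk : 40 ≤ k) :
    thetaOddLo k ≤ (1 / (2 * ((k : ℝ) + 1) - 1) + thetaOddLo ((k : ℝ) + 1)) * cubicLowerRatio k := by
  obtain ⟨j, rfl⟩ : ∃ j, k = j + 40 := ⟨k - 40, by omega⟩
  push_cast
  have h0 : ((j : ℝ) + 40) ≠ 0 := by positivity
  have h1 : ((j : ℝ) + 40 + 1) ≠ 0 := by positivity
  have h2 : (2 * ((j : ℝ) + 40 + 1) - 1) ≠ 0 := ne_of_gt (by linarith [(Nat.cast_nonneg j : (0 : ℝ) ≤ j)])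
  have h3 : (2 * ((j : ℝ) + 40) + 1) ≠ 0 := by positivity
  rw [thetaOddLo, thetaOddLo, cubicLowerRatio, ← sub_nonneg]
  have key : (1 / (2 * (((j : ℝ) + 40) + 1) - 1) + (1 / 3 - 1 / (10 * ((j : ℝ) + 40 + 1)) + 1 / (45 * ((j : ℝ) + 40 + 1) ^ 2))) * ((2 * ((j : ℝ) + 40) + 1) * (16 * ((j : ℝ) + 40) ^ 5 - 16 * ((j : ℝ) + 40) ^ 4 + 20 * ((j : ℝ) + 40) ^ 3 - 25 * ((j : ℝ) + 40) ^ 2 + 29 * ((j : ℝ) + 40) - 36) / (32 * (((j : ℝ) + 40) + 1) * ((j : ℝ) + 40) ^ 5)) - (1 / 3 - 1 / (10 * ((j : ℝ) + 40)) + 1 / (45 * ((j : ℝ) + 40) ^ 2)) =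
      (233254868292 + 34969096049 * (j : ℝ) + 2182135146 * (j : ℝ) ^ 2 + 72556541 * (j : ℝ) ^ 3 + 1355916 * (j : ℝ) ^ 4 + 13504 * (j : ℝ) ^ 5 + 56 * (j : ℝ) ^ 6) /
        (2880 * ((j : ℝ) + 40) ^ 5 * (((j : ℝ) + 40) + 1) ^ 3 * (2 * ((j : ℝ) + 40) + 1)) := by
    field_simp
    ring
  rw [key]
  positivity

/-- Downward closure, weight `1/n`: `θ⁻(k) ≤ (1/(k+1) + θ⁻(k+1))·ρ₋(k)`, `k ≥ 40` (the defect is a polynomial identity with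
non-negative coefficients in `k − 40`). [cite: HaraSladeSokal1993, Appendix B p. 32 (Green functions at the neighbours of the origin); lane certificate] -/
theorem thetaInvLo_closure (k : ℕ) (hk : 40 ≤ k) :
    thetaInvLo k ≤ (1 / ((k : ℝ) + 1) + thetaInvLo ((k : ℝ) + 1)) * cubicLowerRatio k := by
  obtain ⟨j, rfl⟩ : ∃ j, k = j + 40 := ⟨k - 40, by omega⟩
  push_cast
  have h0 : ((j : ℝ) + 40) ≠ 0 := by positivity
  have h1 : ((j : ℝ) + 40 + 1) ≠ 0 := by positivity
  have h2 : (2 * ((j : ℝ) + 40 + 1) - 1) ≠ 0 := ne_of_gt (by linarith [(Nat.cast_nonneg j : (0 : ℝ) ≤ j)])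
  have h3 : (2 * ((j : ℝ) + 40) + 1) ≠ 0 := by positivity
  rw [thetaInvLo, thetaInvLo, cubicLowerRatio, ← sub_nonneg]
  have key : (1 / (((j : ℝ) + 40) + 1) + (2 / 3 - 2 / (5 * ((j : ℝ) + 40 + 1)) + 1 / (5 * ((j : ℝ) + 40 + 1) ^ 2))) * ((2 * ((j : ℝ) + 40) + 1) * (16 * ((j : ℝ) + 40) ^ 5 - 16 * ((j : ℝ) + 40) ^ 4 + 20 * ((j : ℝ) + 40) ^ 3 - 25 * ((j : ℝ) + 40) ^ 2 + 29 * ((j : ℝ) + 40) - 36) / (32 * (((j : ℝ) + 40) + 1) * ((j : ℝ) + 40) ^ 5)) - (2 / 3 - 2 / (5 * ((j : ℝ) + 40)) + 1 / (5 * ((j : ℝ) + 40) ^ 2)) =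
      (38383134328 + 6052167538 * (j : ℝ) + 395988729 * (j : ℝ) ^ 2 + 13768970 * (j : ℝ) ^ 3 + 268463 * (j : ℝ) ^ 4 + 2784 * (j : ℝ) ^ 5 + 12 * (j : ℝ) ^ 6) /
        (480 * ((j : ℝ) + 40) ^ 5 * (((j : ℝ) + 40) + 1) ^ 3 * (((j : ℝ) + 40) + 1)) := by
    field_simp
    ring
  rw [key]
  positivity

/-- Downward closure, weight `1/(n−1)`: `θ⁻(k) ≤ (1/k + θ⁻(k+1))·ρ₋(k)`, `k ≥ 40` (the defect is a polynomial identity with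
non-negative coefficients in `k − 40`). [cite: HaraSladeSokal1993, Appendix B p. 32 (Green functions at the neighbours of the origin); lane certificate] -/
theorem thetaInvPredLo_closure (k : ℕ) (hk : 40 ≤ k) :
    thetaInvPredLo k ≤ (1 / (k : ℝ) + thetaInvPredLo ((k : ℝ) + 1)) * cubicLowerRatio k := by
  obtain ⟨j, rfl⟩ : ∃ j, k = j + 40 := ⟨k - 40, by omega⟩
  push_cast
  have h0 : ((j : ℝ) + 40) ≠ 0 := by positivity
  have h1 : ((j : ℝ) + 40 + 1) ≠ 0 := by positivity
  have h2 : (2 * ((j : ℝ) + 40 + 1) - 1) ≠ 0 := ne_of_gt (by linarith [(Nat.cast_nonneg j : (0 : ℝ) ≤ j)])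
  have h3 : (2 * ((j : ℝ) + 40) + 1) ≠ 0 := by positivity
  rw [thetaInvPredLo, thetaInvPredLo, cubicLowerRatio, ← sub_nonneg]
  have key : (1 / ((j : ℝ) + 40) + (2 / 3 + 1 / (30 * ((j : ℝ) + 40 + 1) ^ 2))) * ((2 * ((j : ℝ) + 40) + 1) * (16 * ((j : ℝ) + 40) ^ 5 - 16 * ((j : ℝ) + 40) ^ 4 + 20 * ((j : ℝ) + 40) ^ 3 - 25 * ((j : ℝ) + 40) ^ 2 + 29 * ((j : ℝ) + 40) - 36) / (32 * (((j : ℝ) + 40) + 1) * ((j : ℝ) + 40) ^ 5)) - (2 / 3 + 1 / (30 * ((j : ℝ) + 40) ^ 2)) =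
      (24514241880 + 3909049154 * (j : ℝ) + 258076947 * (j : ℝ) ^ 2 + 9039323 * (j : ℝ) ^ 3 + 177308 * (j : ℝ) ^ 4 + 1848 * (j : ℝ) ^ 5 + 8 * (j : ℝ) ^ 6) /
        (960 * ((j : ℝ) + 40) ^ 5 * (((j : ℝ) + 40) + 1) ^ 3 * ((j : ℝ) + 40)) := by
    field_simp
    ring
  rw [key]
  positivity

/-! ### §4 The two-sided bounds of the four weighted tails of `qₙ = p_{2n}(0)` (`d = 3`) -/

/-- `θ⁺_one ≥ 0` on `k ≥ 1`. [cite: HaraSladeSokal1993, Appendix A.1 pp. 28–30 (tail of C₀(0,0;1/2d)); lane certificate] -/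
theorem thetaOneUp_nonneg (k : ℕ) (hk : 1 ≤ k) : 0 ≤ thetaOneUp k := by
  have hk' : (1 : ℝ) ≤ k := by exact_mod_cast hk
  have h3 : (1 : ℝ) ≤ (k : ℝ) ^ 3 := one_le_pow₀ hk'
  rw [thetaOneUp, show 2 * (k : ℝ) + 3 / (20 * k) - 1 / (20 * (k : ℝ) ^ 2) = (40 * (k : ℝ) ^ 3 + 3 * k - 1) / (20 * (k : ℝ) ^ 2) by
    field_simp; ring]
  exact div_nonneg (by linarith) (by positivity)

/-- `θ⁻_one ≥ 0` on `k ≥ 1`. [cite: HaraSladeSokal1993, Appendix A.1 pp. 28–30 (tail of C₀(0,0;1/2d)); lane certificate] -/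
theorem thetaOneLo_nonneg (k : ℕ) (hk : 1 ≤ k) : 0 ≤ thetaOneLo k := by
  have hk' : (1 : ℝ) ≤ k := by exact_mod_cast hk
  have h3 : (1 : ℝ) ≤ (k : ℝ) ^ 3 := one_le_pow₀ hk'
  rw [thetaOneLo, show 2 * (k : ℝ) + 3 / (20 * k) - 1 / (8 * (k : ℝ) ^ 2) = (80 * (k : ℝ) ^ 3 + 6 * k - 5) / (40 * (k : ℝ) ^ 2) by
    field_simp; ring]
  exact div_nonneg (by linarith) (by positivity)

/-- `θ⁻_one(k) ≤ 3(k+1)`. [cite: HaraSladeSokal1993, Appendix A.1 pp. 28–30 (tail of C₀(0,0;1/2d)); lane certificate] -/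
theorem thetaOneLo_le (k : ℕ) (hk : 1 ≤ k) : thetaOneLo k ≤ 3 * ((k : ℝ) + 1) := by
  have hk' : (1 : ℝ) ≤ k := by exact_mod_cast hk
  have h1 : 3 / (20 * (k : ℝ)) ≤ 3 / 20 := by
    rw [div_le_div_iff_of_pos_left (by norm_num) (by positivity) (by norm_num)]; linarith
  have h2 : 0 ≤ 1 / (8 * (k : ℝ) ^ 2) := by positivity
  rw [thetaOneLo]
  linarith

/-- `θ⁺_odd ≥ 0` on `k ≥ 1`. [cite: HaraSladeSokal1993, Appendix B p. 32 (Green functions at the neighbours of the origin); lane certificate] -/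
theorem thetaOddUp_nonneg (k : ℕ) (hk : 1 ≤ k) : 0 ≤ thetaOddUp k := by
  have hk' : (1 : ℝ) ≤ k := by exact_mod_cast hk
  rw [thetaOddUp, show 1 / 3 - 1 / (10 * (k : ℝ)) + 1 / (36 * (k : ℝ) ^ 2) = (60 * (k : ℝ) ^ 2 - 18 * k + 5) / (180 * (k : ℝ) ^ 2) by
    field_simp; ring]
  exact div_nonneg (by nlinarith) (by positivity)

/-- `0 ≤ θ⁻_odd ≤ 1` on `k ≥ 1`. [cite: HaraSladeSokal1993, Appendix B p. 32 (Green functions at the neighbours of the origin); lane certificate] -/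
theorem thetaOddLo_nonneg_le (k : ℕ) (hk : 1 ≤ k) : 0 ≤ thetaOddLo k ∧ thetaOddLo k ≤ 1 := by
  have hk' : (1 : ℝ) ≤ k := by exact_mod_cast hk
  have h1 : 1 / (10 * (k : ℝ)) ≤ 1 / 10 := by
    rw [div_le_div_iff_of_pos_left (by norm_num) (by positivity) (by norm_num)]; linarith
  have h1' : 0 ≤ 1 / (10 * (k : ℝ)) := by positivity
  have h2 : 1 / (45 * (k : ℝ) ^ 2) ≤ 1 / 45 := by
    rw [div_le_div_iff_of_pos_left (by norm_num) (by positivity) (by norm_num)]; nlinarith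
  have h2' : 0 ≤ 1 / (45 * (k : ℝ) ^ 2) := by positivity
  rw [thetaOddLo]
  constructor <;> linarith

/-- `θ⁺_inv ≥ 0` on `k ≥ 1`. [cite: HaraSladeSokal1993, Appendix B p. 32 (Green functions at the neighbours of the origin); lane certificate] -/
theorem thetaInvUp_nonneg (k : ℕ) (hk : 1 ≤ k) : 0 ≤ thetaInvUp k := by
  have hk' : (1 : ℝ) ≤ k := by exact_mod_cast hk
  rw [thetaInvUp, show 2 / 3 - 2 / (5 * (k : ℝ)) + 5 / (24 * (k : ℝ) ^ 2) = (80 * (k : ℝ) ^ 2 - 48 * k + 25) / (120 * (k : ℝ) ^ 2) by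
    field_simp; ring]
  exact div_nonneg (by nlinarith) (by positivity)

/-- `0 ≤ θ⁻_inv ≤ 1` on `k ≥ 1`. [cite: HaraSladeSokal1993, Appendix B p. 32 (Green functions at the neighbours of the origin); lane certificate] -/
theorem thetaInvLo_nonneg_le (k : ℕ) (hk : 1 ≤ k) : 0 ≤ thetaInvLo k ∧ thetaInvLo k ≤ 1 := by
  have hk' : (1 : ℝ) ≤ k := by exact_mod_cast hk
  have h1 : 2 / (5 * (k : ℝ)) ≤ 2 / 5 := by
    rw [div_le_div_iff_of_pos_left (by norm_num) (by positivity) (by norm_num)]; linarith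
  have h1' : 0 ≤ 2 / (5 * (k : ℝ)) := by positivity
  have h2 : 1 / (5 * (k : ℝ) ^ 2) ≤ 1 / 5 := by
    rw [div_le_div_iff_of_pos_left (by norm_num) (by positivity) (by norm_num)]; nlinarith
  have h2' : 0 ≤ 1 / (5 * (k : ℝ) ^ 2) := by positivity
  rw [thetaInvLo]
  constructor <;> linarith

/-- `θ⁺_invPred ≥ 0`. [cite: HaraSladeSokal1993, Appendix B p. 32 (Green functions at the neighbours of the origin); lane certificate] -/
theorem thetaInvPredUp_nonneg (k : ℕ) : 0 ≤ thetaInvPredUp k := by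
  rw [thetaInvPredUp]
  positivity

/-- `0 ≤ θ⁻_invPred ≤ 1` on `k ≥ 1`. [cite: HaraSladeSokal1993, Appendix B p. 32 (Green functions at the neighbours of the origin); lane certificate] -/
theorem thetaInvPredLo_nonneg_le (k : ℕ) (hk : 1 ≤ k) : 0 ≤ thetaInvPredLo k ∧ thetaInvPredLo k ≤ 1 := by
  have hk' : (1 : ℝ) ≤ k := by exact_mod_cast hk
  have h2 : 1 / (30 * (k : ℝ) ^ 2) ≤ 1 / 30 := by
    rw [div_le_div_iff_of_pos_left (by norm_num) (by positivity) (by norm_num)]; nlinarith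
  have h2' : 0 ≤ 1 / (30 * (k : ℝ) ^ 2) := by positivity
  rw [thetaInvPredLo]
  constructor <;> linarith

/-- The cubic return probabilities `qₘ = p_{2m}(0)` are summable (their sum is `G₃(0)`).
[cite: HaraSladeSokal1993, Appendix A.1 Table 4 p. 30 (C₀(0,0;1/2d), d = 3); lane certificate] -/
theorem summable_srwLaw_three_origin : Summable fun m : ℕ => srwLaw 3 (2 * m) 0 :=
  (GreenCert.hasSum_srwLaw_two_mul_zero (d := 3) (by norm_num)).summable

/-- A weighted shifted tail `j ↦ w(K+1+j)·q_{K+1+j}` with `0 ≤ w ≤ 1` beyond `K` is summable.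
[cite: HaraSladeSokal1993, Appendix B p. 32 (Green functions at the neighbours of the origin); lane certificate] -/
theorem summable_cubicTail_weighted {w : ℕ → ℝ} (K : ℕ) (hw0 : ∀ n, K + 1 ≤ n → 0 ≤ w n) (hw1 : ∀ n, K + 1 ≤ n → w n ≤ 1) :
    Summable fun j : ℕ => w (K + 1 + j) * srwLaw 3 (2 * (K + 1 + j)) 0 := by
  have hs : Summable fun j : ℕ => srwLaw 3 (2 * (j + (K + 1))) 0 :=
    (summable_nat_add_iff (f := fun m : ℕ => srwLaw 3 (2 * m) 0) (K + 1)).2 summable_srwLaw_three_origin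
  refine Summable.of_nonneg_of_le (fun j => mul_nonneg (hw0 _ (by omega)) (srwLaw_nonneg _ _)) (fun j => ?_) hs
  rw [show j + (K + 1) = K + 1 + j by ring]
  exact mul_le_of_le_one_left (srwLaw_nonneg _ _) (hw1 _ (by omega))

/-- **Weight `1`, upper:** `Σ_{j} q_{K+1+j} ≤ θ⁺_one(K)·q_K` (`K ≥ 2`).
[cite: HaraSladeSokal1993, Appendix A.1 pp. 28–30 (tail of C₀(0,0;1/2d)); lane certificate] -/
theorem tsum_cubicTail_one_le (K : ℕ) (hK : 2 ≤ K) :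
    ∑' j, srwLaw 3 (2 * (K + 1 + j)) 0 ≤ thetaOneUp K * srwLaw 3 (2 * K) 0 := by
  have hq : ∀ m, 0 ≤ srwLaw 3 (2 * m) 0 := fun m => srwLaw_nonneg _ _
  refine Real.tsum_le_of_sum_range_le (fun j => hq _) (fun M => ?_)
  have h := sum_range_weighted_le_of_potential (q := fun m => srwLaw 3 (2 * m) 0)
    (r := fun m => Watson.cubicReturnRatio ((m : ℝ) + 1)) (t := fun m => thetaOneUp m) (w := fun _ => (1 : ℝ)) K
    hq (fun _ _ => zero_le_one) (fun m hm => thetaOneUp_nonneg m (by omega))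
    (fun m hm => Watson.srwLaw_three_succ_le m (by omega))
    (fun m hm => by
      have h := thetaOneUp_closure m (by omega)
      push_cast at h ⊢
      exact h) M
  simpa using h

/-- **Weight `1`, lower:** `θ⁻_one(K)·q_K ≤ Σ_{j} q_{K+1+j}` (`K ≥ 40`).
[cite: HaraSladeSokal1993, Appendix A.1 pp. 28–30 (tail of C₀(0,0;1/2d)); lane certificate] -/
theorem le_tsum_cubicTail_one (K : ℕ) (hK : 40 ≤ K) :
    thetaOneLo K * srwLaw 3 (2 * K) 0 ≤ ∑' j, srwLaw 3 (2 * (K + 1 + j)) 0 := by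
  have hq : ∀ m, 0 ≤ srwLaw 3 (2 * m) 0 := fun m => srwLaw_nonneg _ _
  have h := potential_le_tsum_weighted (q := fun m => srwLaw 3 (2 * m) 0) (r := fun m => cubicLowerRatio m)
    (t := fun m => thetaOneLo m) (w := fun _ => (1 : ℝ)) K hq (fun _ _ => zero_le_one)
    (fun m hm => thetaOneLo_nonneg m (by omega)) (c := 3) (by norm_num) (fun m hm => thetaOneLo_le m (by omega))
    (fun m hm => srwLaw_three_succ_ge m (by omega))
    (fun m hm => by
      have h := thetaOneLo_closure m (by omega)
      simpa using h)
    summable_srwLaw_three_origin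
    (by simpa using summable_cubicTail_weighted (w := fun _ => (1 : ℝ)) K (fun _ _ => zero_le_one) (fun _ _ => le_rfl))
  simpa using h

/-- **Weight `1/(2n−1)`, upper:** `Σ_{j} q_{K+1+j}/(2(K+1+j)−1) ≤ θ⁺_odd(K)·q_K` (`K ≥ 2`).
[cite: HaraSladeSokal1993, Appendix B p. 32 (Green functions at the neighbours of the origin); lane certificate] -/
theorem tsum_cubicTail_odd_le (K : ℕ) (hK : 2 ≤ K) :
    ∑' j, 1 / (2 * ((K + 1 + j : ℕ) : ℝ) - 1) * srwLaw 3 (2 * (K + 1 + j)) 0 ≤ thetaOddUp K * srwLaw 3 (2 * K) 0 := by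
  have hq : ∀ m, 0 ≤ srwLaw 3 (2 * m) 0 := fun m => srwLaw_nonneg _ _
  have hw : ∀ n : ℕ, K + 1 ≤ n → 0 ≤ 1 / (2 * (n : ℝ) - 1) := fun n hn => by
    have : (1 : ℝ) ≤ n := by exact_mod_cast (show 1 ≤ n by omega)
    exact div_nonneg zero_le_one (by linarith)
  refine Real.tsum_le_of_sum_range_le (fun j => mul_nonneg (hw _ (by omega)) (hq _)) (fun M => ?_)
  exact sum_range_weighted_le_of_potential (q := fun m => srwLaw 3 (2 * m) 0)
    (r := fun m => Watson.cubicReturnRatio ((m : ℝ) + 1)) (t := fun m => thetaOddUp m) (w := fun n => 1 / (2 * (n : ℝ) - 1)) K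
    hq hw (fun m hm => thetaOddUp_nonneg m (by omega))
    (fun m hm => Watson.srwLaw_three_succ_le m (by omega))
    (fun m hm => by
      have h := thetaOddUp_closure m (by omega)
      push_cast at h ⊢
      exact h) M

/-- **Weight `1/(2n−1)`, lower:** `θ⁻_odd(K)·q_K ≤ Σ_{j} q_{K+1+j}/(2(K+1+j)−1)` (`K ≥ 40`).
[cite: HaraSladeSokal1993, Appendix B p. 32 (Green functions at the neighbours of the origin); lane certificate] -/
theorem le_tsum_cubicTail_odd (K : ℕ) (hK : 40 ≤ K) :
    thetaOddLo K * srwLaw 3 (2 * K) 0 ≤ ∑' j, 1 / (2 * ((K + 1 + j : ℕ) : ℝ) - 1) * srwLaw 3 (2 * (K + 1 + j)) 0 := by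
  have hq : ∀ m, 0 ≤ srwLaw 3 (2 * m) 0 := fun m => srwLaw_nonneg _ _
  have hw : ∀ n : ℕ, K + 1 ≤ n → 0 ≤ 1 / (2 * (n : ℝ) - 1) := fun n hn => by
    have : (1 : ℝ) ≤ n := by exact_mod_cast (show 1 ≤ n by omega)
    exact div_nonneg zero_le_one (by linarith)
  have hw1 : ∀ n : ℕ, K + 1 ≤ n → 1 / (2 * (n : ℝ) - 1) ≤ 1 := fun n hn => by
    have : (2 : ℝ) ≤ n := by exact_mod_cast (show 2 ≤ n by omega)
    rw [div_le_one (by linarith)]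
    linarith
  exact potential_le_tsum_weighted (q := fun m => srwLaw 3 (2 * m) 0) (r := fun m => cubicLowerRatio m)
    (t := fun m => thetaOddLo m) (w := fun n => 1 / (2 * (n : ℝ) - 1)) K hq hw
    (fun m hm => (thetaOddLo_nonneg_le m (by omega)).1) (c := 1) zero_le_one
    (fun m hm => by
      have h := (thetaOddLo_nonneg_le m (by omega)).2
      have : (0 : ℝ) ≤ m := Nat.cast_nonneg m
      linarith)
    (fun m hm => srwLaw_three_succ_ge m (by omega))
    (fun m hm => by
      have h := thetaOddLo_closure m (by omega)
      push_cast at h ⊢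
      exact h)
    summable_srwLaw_three_origin (summable_cubicTail_weighted K hw hw1)

/-- **Weight `1/n`, upper:** `Σ_{j} q_{K+1+j}/(K+1+j) ≤ θ⁺_inv(K)·q_K` (`K ≥ 2`).
[cite: HaraSladeSokal1993, Appendix B p. 32 (Green functions at the neighbours of the origin); lane certificate] -/
theorem tsum_cubicTail_inv_le (K : ℕ) (hK : 2 ≤ K) :
    ∑' j, 1 / ((K + 1 + j : ℕ) : ℝ) * srwLaw 3 (2 * (K + 1 + j)) 0 ≤ thetaInvUp K * srwLaw 3 (2 * K) 0 := by
  have hq : ∀ m, 0 ≤ srwLaw 3 (2 * m) 0 := fun m => srwLaw_nonneg _ _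
  have hw : ∀ n : ℕ, K + 1 ≤ n → 0 ≤ 1 / (n : ℝ) := fun n _ => by positivity
  refine Real.tsum_le_of_sum_range_le (fun j => mul_nonneg (hw _ (by omega)) (hq _)) (fun M => ?_)
  exact sum_range_weighted_le_of_potential (q := fun m => srwLaw 3 (2 * m) 0)
    (r := fun m => Watson.cubicReturnRatio ((m : ℝ) + 1)) (t := fun m => thetaInvUp m) (w := fun n => 1 / (n : ℝ)) K
    hq hw (fun m hm => thetaInvUp_nonneg m (by omega))
    (fun m hm => Watson.srwLaw_three_succ_le m (by omega))
    (fun m hm => by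
      have h := thetaInvUp_closure m (by omega)
      push_cast at h ⊢
      exact h) M
set_option maxHeartbeats 400000 in
/-- **Weight `1/n`, lower:** `θ⁻_inv(K)·q_K ≤ Σ_{j} q_{K+1+j}/(K+1+j)` (`K ≥ 40`).
[cite: HaraSladeSokal1993, Appendix B p. 32 (Green functions at the neighbours of the origin); lane certificate] -/
theorem le_tsum_cubicTail_inv (K : ℕ) (hK : 40 ≤ K) :
    thetaInvLo K * srwLaw 3 (2 * K) 0 ≤ ∑' j, 1 / ((K + 1 + j : ℕ) : ℝ) * srwLaw 3 (2 * (K + 1 + j)) 0 := by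
  have hq : ∀ m, 0 ≤ srwLaw 3 (2 * m) 0 := fun m => srwLaw_nonneg _ _
  have hw : ∀ n : ℕ, K + 1 ≤ n → 0 ≤ 1 / (n : ℝ) := fun n _ => by positivity
  have hw1 : ∀ n : ℕ, K + 1 ≤ n → 1 / (n : ℝ) ≤ 1 := fun n hn => by
    have : (1 : ℝ) ≤ n := by exact_mod_cast (show 1 ≤ n by omega)
    rw [div_le_one (by linarith)]
    linarith
  exact potential_le_tsum_weighted (q := fun m => srwLaw 3 (2 * m) 0) (r := fun m => cubicLowerRatio m)
    (t := fun m => thetaInvLo m) (w := fun n => 1 / (n : ℝ)) K hq hw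
    (fun m hm => (thetaInvLo_nonneg_le m (by omega)).1) (c := 1) zero_le_one
    (fun m hm => by
      have h := (thetaInvLo_nonneg_le m (by omega)).2
      have : (0 : ℝ) ≤ m := Nat.cast_nonneg m
      linarith)
    (fun m hm => srwLaw_three_succ_ge m (by omega))
    (fun m hm => by
      have h := thetaInvLo_closure m (by omega)
      push_cast at h ⊢
      exact h)
    summable_srwLaw_three_origin (summable_cubicTail_weighted K hw hw1)

/-- **Weight `1/(n−1)`, upper:** `Σ_{j} q_{K+1+j}/(K+j) ≤ θ⁺_invPred(K)·q_K` (`K ≥ 2`).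
[cite: HaraSladeSokal1993, Appendix B p. 32 (Green functions at the neighbours of the origin); lane certificate] -/
theorem tsum_cubicTail_invPred_le (K : ℕ) (hK : 2 ≤ K) :
    ∑' j, 1 / (((K + 1 + j : ℕ) : ℝ) - 1) * srwLaw 3 (2 * (K + 1 + j)) 0 ≤ thetaInvPredUp K * srwLaw 3 (2 * K) 0 := by
  have hq : ∀ m, 0 ≤ srwLaw 3 (2 * m) 0 := fun m => srwLaw_nonneg _ _
  have hw : ∀ n : ℕ, K + 1 ≤ n → 0 ≤ 1 / ((n : ℝ) - 1) := fun n hn => by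
    have : (1 : ℝ) ≤ n := by exact_mod_cast (show 1 ≤ n by omega)
    exact div_nonneg zero_le_one (by linarith)
  refine Real.tsum_le_of_sum_range_le (fun j => mul_nonneg (hw _ (by omega)) (hq _)) (fun M => ?_)
  exact sum_range_weighted_le_of_potential (q := fun m => srwLaw 3 (2 * m) 0)
    (r := fun m => Watson.cubicReturnRatio ((m : ℝ) + 1)) (t := fun m => thetaInvPredUp m) (w := fun n => 1 / ((n : ℝ) - 1)) K
    hq hw (fun m hm => thetaInvPredUp_nonneg m)
    (fun m hm => Watson.srwLaw_three_succ_le m (by omega))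
    (fun m hm => by
      have h := thetaInvPredUp_closure m (by omega)
      push_cast at h ⊢
      ring_nf at h ⊢
      exact h) M

/-- **Weight `1/(n−1)`, lower:** `θ⁻_invPred(K)·q_K ≤ Σ_{j} q_{K+1+j}/(K+j)` (`K ≥ 40`).
[cite: HaraSladeSokal1993, Appendix B p. 32 (Green functions at the neighbours of the origin); lane certificate] -/
theorem le_tsum_cubicTail_invPred (K : ℕ) (hK : 40 ≤ K) :
    thetaInvPredLo K * srwLaw 3 (2 * K) 0 ≤ ∑' j, 1 / (((K + 1 + j : ℕ) : ℝ) - 1) * srwLaw 3 (2 * (K + 1 + j)) 0 := by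
  have hq : ∀ m, 0 ≤ srwLaw 3 (2 * m) 0 := fun m => srwLaw_nonneg _ _
  have hw : ∀ n : ℕ, K + 1 ≤ n → 0 ≤ 1 / ((n : ℝ) - 1) := fun n hn => by
    have : (1 : ℝ) ≤ n := by exact_mod_cast (show 1 ≤ n by omega)
    exact div_nonneg zero_le_one (by linarith)
  have hw1 : ∀ n : ℕ, K + 1 ≤ n → 1 / ((n : ℝ) - 1) ≤ 1 := fun n hn => by
    have : (2 : ℝ) ≤ n := by exact_mod_cast (show 2 ≤ n by omega)
    rw [div_le_one (by linarith)]
    linarith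
  exact potential_le_tsum_weighted (q := fun m => srwLaw 3 (2 * m) 0) (r := fun m => cubicLowerRatio m)
    (t := fun m => thetaInvPredLo m) (w := fun n => 1 / ((n : ℝ) - 1)) K hq hw
    (fun m hm => (thetaInvPredLo_nonneg_le m (by omega)).1) (c := 1) zero_le_one
    (fun m hm => by
      have h := (thetaInvPredLo_nonneg_le m (by omega)).2
      have : (0 : ℝ) ≤ m := Nat.cast_nonneg m
      linarith)
    (fun m hm => srwLaw_three_succ_ge m (by omega))
    (fun m hm => by
      have h := thetaInvPredLo_closure m (by omega)
      push_cast at h ⊢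
      ring_nf at h ⊢
      exact h)
    summable_srwLaw_three_origin (summable_cubicTail_weighted K hw hw1)

end GreenThree

end Literature.Probability.RandomPlanarGeometry.SAW.Zd.LoopErasure
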